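import Mathlib
import Summits.Ventures.PercRepro2.Defs
import Summits.Ventures.PercRepro2.Independence
import Summits.Ventures.PercRepro2.Harris
import Summits.Ventures.PercRepro2.Graph
import Summits.Ventures.PercRepro2.Exploration
import Summits.Ventures.PercRepro2.Events
import Summits.Ventures.PercRepro2.Statements
import Summits.Ventures.PercRepro2.FourFunctions
import Summits.Ventures.PercRepro2.Induced
import Summits.Ventures.PercRepro2.Frontier
import Summits.Ventures.PercRepro2.ObsIndependence
import Summits.Ventures.PercRepro2.BHK
import Summits.Ventures.PercRepro2.BHKEvents
import Summits.Ventures.PercRepro2.ClusterProperty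
import Summits.Ventures.PercRepro2.BHKPair
import Summits.Ventures.PercRepro2.CondAvoidPA
import Summits.Ventures.PercRepro2.CondAvoidZPA
import Summits.Ventures.PercRepro2.BoxUnionDefs
import Summits.Ventures.PercRepro2.BoxUnion
import Summits.Ventures.PercRepro2.BoxUnionPair
import Summits.Ventures.PercRepro2.PairTP2
import Summits.Ventures.PercRepro2.PairTP2Main
import Summits.Ventures.PercRepro2.UnionRowMech
import Summits.Ventures.PercRepro2.UnionRowMech2
import Summits.Ventures.PercRepro2.UnionRowGrid
import Summits.Ventures.PercRepro2.UnionRowGrid2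

/-!
# The two-status union row in the cell's own form — part 1: observables and union cells
(blind cell PercRepro2, mine-1 g39; proofs/MINE1-UNIONROW2.md §7)

The grid theorems of `UnionRowGrid` / `UnionRowGrid2` are transported to the vocabulary of
`BoxUnionPair.hit_boxUnion_nonneg`: for an up-set `A` of the status grid, the observable
`obs A : Finset V → Finset V → ℝ`, `obs A W C = 1[(code W C u, code W C v) ∈ A]`, is increasing in
`C_s` and decreasing in `C_t` (`obs_zmono`); the expectation
`E[(obs A(σ) − E[obs A(σ) | Q]) (obs B(σ) − E[obs B(σ) | Q]) · 1_{Q ∩ ({s ↮ X} ∪ {t ↮ Y})}]`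
is `Z⁻²` times the grid sum over the union cells `U_XY` (`row_eq_gridRow`), and the grid sum is
nonnegative by the grid theorems in every case — `U_XY` always contains every cell but the two
double-hit cells, so the four union types are the four membership patterns of `(S,T), (T,S)` in
`U_XY` (`mem_unionCells_of_ne`).

This part: the observables `obs`, their (Z)-monotonicity, their values at the grid points
(`obs_iota`), the reduction of sums against the status law to the nine grid points
(`sum_pairLaw_eq_grid`), the conditional mean `condMean_obs = M(A)/Z`, and the union cells
`unionCells` with `mem_boxUnion_iota` and `mem_unionCells_of_ne`. The identification and the
theorem are in `UnionRowCell`.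
-/

namespace Summit.Ventures.PercRepro2

namespace UnionRowCell

open Finset UnionRowMech UnionRowGrid
open scoped Classical

variable {V : Type*} {E : Type*} [Fintype V] [DecidableEq V] [Fintype E] [DecidableEq E]
variable (ends : E → Sym2 V) (s t u v : V) {p : E → ℝ}

/-! ### The observables -/

/-- The status code from the two observed clusters (`Finset` form). -/
def fcode (W C : Finset V) (x : V) : Fin 3 := if x ∈ W then 2 else if x ∈ C then 0 else 1

/-- The up-set observable `1[(code u, code v) ∈ A]` of the two observed clusters. -/
def obs (A : Finset Grid) (W C : Finset V) : ℝ :=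
  if (fcode W C u, fcode W C v) ∈ A then 1 else 0

omit [Fintype V] [Fintype E] [DecidableEq E] in
/-- The code is monotone. -/
lemma fcode_mono {W W' C C' : Finset V} (hW : W ⊆ W') (hC : C' ⊆ C) (x : V) :
    fcode W C x ≤ fcode W' C' x := by
  unfold fcode
  by_cases h1 : x ∈ W
  · rw [if_pos h1, if_pos (hW h1)]
  · rw [if_neg h1]
    by_cases h2 : x ∈ C
    · rw [if_pos h2]
      split_ifs <;> decide
    · rw [if_neg h2, if_neg (fun h => h2 (hC h))]
      split_ifs <;> decide

omit [Fintype V] [Fintype E] [DecidableEq E] in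
/-- The up-set observable is increasing in `C_s` and decreasing in `C_t`. -/
lemma obs_zmono {A : Finset Grid} (hA : IsUp A) :
    ∀ ⦃W W' C C' : Finset V⦄, W ⊆ W' → C' ⊆ C → obs u v A W C ≤ obs u v A W' C' := by
  intro W W' C C' hW hC
  unfold obs
  by_cases h : (fcode W C u, fcode W C v) ∈ A
  · rw [if_pos h, if_pos (hA ⟨fcode_mono hW hC u, fcode_mono hW hC v⟩ h)]
  · rw [if_neg h]
    split_ifs <;> norm_num

/-! ### The observable at a grid point -/

/-- A code that is neither `2` nor `0` is `1`. -/
lemma fin3_eq_one {a : Fin 3} (h2 : a ≠ 2) (h0 : a ≠ 0) : a = 1 := by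
  revert a; decide

omit [Fintype V] [Fintype E] [DecidableEq E] in
/-- The code of `u` at the grid point `iota u v k` is `k.1`. -/
lemma fcode_iota_fst (hne : u ≠ v) (k : Grid) :
    fcode (PairTP2.iota u v k).1 (OrderDual.ofDual (PairTP2.iota u v k).2) u = k.1 := by
  unfold fcode
  have h1 : u ∈ (PairTP2.iota u v k).1 ↔ k.1 = 2 := by
    rw [PairTP2.mem_iota_fst]
    constructor
    · rintro (⟨-, h⟩ | ⟨h, -⟩)
      · exact h
      · exact absurd h hne
    · intro h; exact Or.inl ⟨rfl, h⟩
  have h2 : u ∈ OrderDual.ofDual (PairTP2.iota u v k).2 ↔ k.1 = 0 := by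
    rw [PairTP2.mem_iota_snd]
    constructor
    · rintro (⟨-, h⟩ | ⟨h, -⟩)
      · exact h
      · exact absurd h hne
    · intro h; exact Or.inl ⟨rfl, h⟩
  by_cases ha : k.1 = 2
  · rw [if_pos (h1.2 ha), ha]
  · rw [if_neg (fun h => ha (h1.1 h))]
    by_cases hb : k.1 = 0
    · rw [if_pos (h2.2 hb), hb]
    · rw [if_neg (fun h => hb (h2.1 h))]
      exact (fin3_eq_one ha hb).symm

omit [Fintype V] [Fintype E] [DecidableEq E] in
/-- The code of `v` at the grid point `iota u v k` is `k.2`. -/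
lemma fcode_iota_snd (hne : u ≠ v) (k : Grid) :
    fcode (PairTP2.iota u v k).1 (OrderDual.ofDual (PairTP2.iota u v k).2) v = k.2 := by
  unfold fcode
  have h1 : v ∈ (PairTP2.iota u v k).1 ↔ k.2 = 2 := by
    rw [PairTP2.mem_iota_fst]
    constructor
    · rintro (⟨h, -⟩ | ⟨-, h⟩)
      · exact absurd h.symm hne
      · exact h
    · intro h; exact Or.inr ⟨rfl, h⟩
  have h2 : v ∈ OrderDual.ofDual (PairTP2.iota u v k).2 ↔ k.2 = 0 := by
    rw [PairTP2.mem_iota_snd]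
    constructor
    · rintro (⟨h, -⟩ | ⟨-, h⟩)
      · exact absurd h.symm hne
      · exact h
    · intro h; exact Or.inr ⟨rfl, h⟩
  by_cases ha : k.2 = 2
  · rw [if_pos (h1.2 ha), ha]
  · rw [if_neg (fun h => ha (h1.1 h))]
    by_cases hb : k.2 = 0
    · rw [if_pos (h2.2 hb), hb]
    · rw [if_neg (fun h => hb (h2.1 h))]
      exact (fin3_eq_one ha hb).symm

omit [Fintype V] [Fintype E] [DecidableEq E] in
/-- The observable at a grid point is the indicator of the cell. -/
lemma obs_iota (hne : u ≠ v) (A : Finset Grid) (k : Grid) :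
    obs u v A (PairTP2.iota u v k).1 (OrderDual.ofDual (PairTP2.iota u v k).2) =
      if k ∈ A then 1 else 0 := by
  unfold obs
  rw [fcode_iota_fst u v hne, fcode_iota_snd u v hne]

/-! ### Sums over the (Z)-lattice reduce to the grid -/

/-- A sum against the status law reduces to the nine grid points. -/
lemma sum_pairLaw_eq_grid (hne : u ≠ v) (h : BoxUnionPair.ZLat V → ℝ) :
    ∑ x, BoxUnionPair.pairLaw p ends {u, v} s t x * h x =
      ∑ k : Grid, gridMass ends s t u v p k * h (PairTP2.iota u v k) := by
  have himg : ∑ x ∈ (Finset.univ : Finset Grid).image (PairTP2.iota u v),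
      BoxUnionPair.pairLaw p ends {u, v} s t x * h x =
      ∑ k : Grid, BoxUnionPair.pairLaw p ends {u, v} s t (PairTP2.iota u v k) *
        h (PairTP2.iota u v k) :=
    Finset.sum_image (fun k _ k' _ hk => PairTP2.iota_injective hne hk)
  rw [← Finset.sum_subset (Finset.subset_univ _) (fun x _ hx => ?_), himg]
  · refine Finset.sum_congr rfl fun k _ => ?_
    rw [PairTP2.mass_eq ends s t hne k.1 k.2]
    rfl
  · rw [PairTP2.pairLaw_eq_zero_of_not_grid ends s t hne x (fun k hk => hx
      (Finset.mem_image_of_mem _ (Finset.mem_univ k) |> fun h => hk ▸ h)), zero_mul]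

/-- The conditional mean of an up-set observable is `M(A) / Z`. -/
lemma condMean_obs (hne : u ≠ v) (A : Finset Grid) :
    BoxUnionPair.condMean p ends {u, v} s t
        (fun k => obs u v A k.1 (OrderDual.ofDual k.2)) =
      mass (gridMass ends s t u v p) A / total (gridMass ends s t u v p) := by
  rw [← BoxUnionPair.mean_pairLaw]
  unfold BoxUnion.mean
  rw [sum_pairLaw_eq_grid ends s t u v hne, BoxUnionPair.sum_pairLaw,
    ← total_gridMass_eq]
  congr 1
  unfold mass
  simp_rw [obs_iota u v hne, mul_ite, mul_one, mul_zero]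
  rw [← Finset.sum_filter, Finset.filter_mem_eq_inter, Finset.univ_inter]

/-! ### The union cells -/

/-- The cells of the union event `{s ↮ X} ∪ {t ↮ Y}` on the grid. -/
def unionCells (X Y : Finset V) : Finset Grid :=
  Finset.univ.filter (fun k =>
    ((u ∈ X → k.1 ≠ 2) ∧ (v ∈ X → k.2 ≠ 2)) ∨ ((u ∈ Y → k.1 ≠ 0) ∧ (v ∈ Y → k.2 ≠ 0)))

omit [Fintype V] [Fintype E] [DecidableEq E] in
/-- Membership in the union event at a grid point. -/
lemma mem_boxUnion_iota (hne : u ≠ v) (X Y : Finset V) (k : Grid) :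
    ((PairTP2.iota u v k).1 ∩ X = ∅ ∨ OrderDual.ofDual (PairTP2.iota u v k).2 ∩ Y = ∅) ↔
      k ∈ unionCells u v X Y := by
  simp only [unionCells, Finset.mem_filter, Finset.mem_univ, true_and,
    Finset.eq_empty_iff_forall_notMem, Finset.mem_inter, not_and, PairTP2.mem_iota_fst,
    PairTP2.mem_iota_snd]
  constructor
  · rintro (h | h)
    · left
      refine ⟨fun hu h2 => h u (Or.inl ⟨rfl, h2⟩) hu, fun hv h2 => h v (Or.inr ⟨rfl, h2⟩) hv⟩
    · right
      refine ⟨fun hu h0 => h u (Or.inl ⟨rfl, h0⟩) hu, fun hv h0 => h v (Or.inr ⟨rfl, h0⟩) hv⟩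
  · rintro (h | h)
    · left
      rintro x (⟨rfl, h2⟩ | ⟨rfl, h2⟩) hx
      · exact h.1 hx h2
      · exact h.2 hx h2
    · right
      rintro x (⟨rfl, h0⟩ | ⟨rfl, h0⟩) hx
      · exact h.1 hx h0
      · exact h.2 hx h0

omit [Fintype V] [DecidableEq V] [Fintype E] [DecidableEq E] in
/-- Every cell other than the two double-hit cells has no `2` or no `0` among its coordinates. -/
lemma no_two_or_no_zero : ∀ k : Grid, k ≠ (2, 0) → k ≠ (0, 2) →
    (k.1 ≠ 2 ∧ k.2 ≠ 2) ∨ (k.1 ≠ 0 ∧ k.2 ≠ 0) := by decide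

omit [Fintype V] [Fintype E] [DecidableEq E] in
/-- Every cell other than the two double-hit cells lies in every union event. -/
lemma mem_unionCells_of_ne (X Y : Finset V) {k : Grid} (h1 : k ≠ UnionRowMech.ST)
    (h2 : k ≠ TS) : k ∈ unionCells u v X Y := by
  simp only [unionCells, Finset.mem_filter, Finset.mem_univ, true_and]
  rcases no_two_or_no_zero k h1 h2 with ⟨a, b⟩ | ⟨a, b⟩
  · exact Or.inl ⟨fun _ => a, fun _ => b⟩
  · exact Or.inr ⟨fun _ => a, fun _ => b⟩

end UnionRowCell

end Summit.Ventures.PercRepro2
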